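import Summits.BirchSwinnertonDyer.BirchSwinnertonDyer.Theorems.ResidualThetaTransportAtTwoAwayDefs
import HarnessLib

/-!
# Route `ResidualThetaTransportAtTwo` (RTT) — definition file 3: the ONE-PAIR SUPPLY DATUM `(P, pair, locd)` of the glue `stub_onePairSupply`
# (crux RSL_g `ResidualSignedLambdaLowerCMAtTwo`, stmt-BirchSwinnertonDyer-22608; ASSEMBLY-SPEC-g19 §0)

Cell `bsd-wall`, LEAD `prover-bsd-wall-rtt-p2` g19. Companion of `…Defs` (`OnePairPins`) and `…AwayDefs` (`AwayPins`, `PAway`, `locAway`). The registered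
glue stub `stub_onePairSupply` of `Cruxes/ResidualSignedLambdaLowerCMAtTwo/Lines/onepair.lean` (v3d) concludes with the N5 datum `∃ P pair locd Z Sel₀ e f B, …`;
`Cruxes/…/ASSEMBLY-SPEC-g19.md` splits its proof into eight clause files C0–C8 written by several seats against ONE choice of the objects. THIS FILE
fixes that choice (DATA-valued definitions + unfolding lemmas + the two structural facts every clause uses; no `Prop`-valued definition, no instance,
no notation, nothing of the crux asserted):

* `OnePairPins.colN π : P₀ →ₗ[ℤ₂] Λₙ` — the plus Coleman map on `n`-tuples of functionals, `t ↦ (col (t ∘ single i))_i` (`P₀ = Hom(E(ℚ_{∞,v})ⁿ, ℤ₂)`,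
  `Λₙ = ℤ₂⟦X⟧ⁿ`); `colN_apply`, `colN_surjective` (from `π.hcol_surj`), `cvec_eq_colN_locd₂` (`𝒸 = colN ∘ locd₂`, `rfl`);
* `OnePairPins.cvecHom π : I.H →+ Λₙ` — `𝒸` as an additive map; `cvecHom_apply` (`rfl`);
* `OnePair.pairAway S κ ρ S₀ Sg : PAway →+ CharacterModule ↥Sg` — the S₀-side pairing `χ ↦ (s ↦ ∑_w ∑ᶠ_c χ w c (locAway s w c))` (the texts' sum, `cS := id`);
* `OnePair.supplyLocd π πₐ : I.H →+ Λₙ × PAway` — `x ↦ (𝒸 x, locd_S x)`;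
* `OnePair.supplyPair c̄₂ : Λₙ × PAway →+ CharacterModule ↥Sg` — `(F, χ) ↦ c̄₂ F + pairAway χ`, for ANY `c̄₂ : Λₙ →+ Sg⋆` (the assembly takes the DESCENT of
  S2's `pair₂` along `colN`, which exists by `exists_descend_of_ker_colN`).

BSD is not proved by any of this; RSL_g is OPEN.

References: [Kobayashi2003] Thm. 6.2, Thm. 7.3; [Kato2004Asterisque] §13.8; [GreenbergVatsal2000] §2 Prop. 2.4; [PerrinRiou1994Invent] §3.6.1.
-/

set_option autoImplicit false
-- the Theorems namespace of this sub repeats the summit name by design (D-0017 nested layout)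
set_option linter.dupNamespace false

noncomputable section

open scoped Classical

namespace Summit.BirchSwinnertonDyer.BirchSwinnertonDyer.Theorems.OnePair

open Literature.NumberTheory.EllipticCurves Literature.NumberTheory.EllipticCurves.GreenbergSelmer
open Literature.NumberTheory.GaloisRepresentations NumberField IsDedekindDomain Field
open Literature.NumberTheory.EllipticCurves GreenbergSelmer Kobayashi2003 Literature.NumberTheory.GaloisRepresentations
  IsDedekindDomain NumberField Field Rat.HeightOneSpectrum PowerSeries

/-! ## §1 The plus Coleman map on `n`-tuples and `𝒸` as an additive map -/

namespace OnePairPins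

variable {S : Set (PadicAlgCl 2)} {W : WeierstrassCurve ℚ} [W.IsElliptic] {κ : ZpExtension ℚ 2} {γ : absoluteGaloisGroup ℚ}
  {S₀ : Finset (HeightOneSpectrum (𝓞 ℚ))} {n : ℕ} {ρ : FramedGaloisRep ℚ ↥(padicCoeffIntegers S) 2}
  {Θ : ∀ v : HeightOneSpectrum (𝓞 ℚ), ((2 : ℕ) : 𝓞 ℚ) ∈ v.asIdeal → (Cofree ρ ↥(padicCoeffField S) ≃+ (Fin n → ↥(W.geomPrimaryTorsion 2)))}
  {hΘ : ∀ v hv (δ : absoluteGaloisGroup (v.adicCompletion ℚ)) m i,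
    Θ v hv (resGalOfEmb (closureEmb (K := ℚ) (v.adicCompletion ℚ)) δ • m) i = resGalOfEmb (closureEmb (K := ℚ) (v.adicCompletion ℚ)) δ • Θ v hv m i}
  {I : Kato2004.IwasawaH1DataCoeff (FramedGaloisRep.toGaloisRep ρ) 2 κ γ}
  {Sg : AddSubgroup (subgroupH1 κ.kerSubgroup (Cofree ρ ↥(padicCoeffField S)))} [Module ↥(padicCoeffIntegers S) ↥Sg]
  (π : OnePairPins S W κ γ S₀ n ρ Θ hΘ I Sg)

/-- **`colN : Hom(E(ℚ_{∞,v})ⁿ, ℤ₂) →ₗ[ℤ₂] ℤ₂⟦X⟧ⁿ`**, `t ↦ (col (t ∘ single i))_i` — the plus Coleman map of the pins on `n`-tuples of functionals (the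
coarsening `P₀ ↠ Λₙ` of the glue). [cite: Kobayashi2003, Thm. 6.2 (p. 18)] -/
def colN : ((Fin n → ↥(Sprung2012.localTowerPointsOfEmb κ (closureEmb (K := ℚ) (π.v.adicCompletion ℚ)) W)) →+ ℤ_[2]) →ₗ[ℤ_[2]]
    (Fin n → PowerSeries ℤ_[2]) where
  toFun t := fun i ↦ π.col (t.comp (AddMonoidHom.single
    (fun _ : Fin n => ↥(Sprung2012.localTowerPointsOfEmb κ (closureEmb (K := ℚ) (π.v.adicCompletion ℚ)) W)) i))
  map_add' t t' := funext fun i ↦ by rw [Pi.add_apply, AddMonoidHom.add_comp, map_add]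
  map_smul' c t := funext fun i ↦ by
    rw [Pi.smul_apply, RingHom.id_apply, ← map_smul]
    exact congrArg π.col (AddMonoidHom.ext fun _ ↦ rfl)

/-- Unfolding `colN` (definitional). [cite: Kobayashi2003, Thm. 6.2 (p. 18)] -/
theorem colN_apply (t : (Fin n → ↥(Sprung2012.localTowerPointsOfEmb κ (closureEmb (K := ℚ) (π.v.adicCompletion ℚ)) W)) →+ ℤ_[2]) (i : Fin n) :
    π.colN t i = π.col (t.comp (AddMonoidHom.single
      (fun _ : Fin n => ↥(Sprung2012.localTowerPointsOfEmb κ (closureEmb (K := ℚ) (π.v.adicCompletion ℚ)) W)) i)) :=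
  rfl

/-- `𝒸 = colN ∘ locd₂` (definitional). [cite: Kobayashi2003, Thm. 6.2 (p. 18)] -/
theorem cvec_eq_colN_locd₂ (x : I.H) : π.cvec x = π.colN (π.locd₂ x) := rfl

/-- **`colN` is onto** (each coordinate `col` is onto, `π.hcol_surj`; glue the preimages with the projections). [cite: Kobayashi2003, Thm. 6.2 (p. 18)] -/
theorem colN_surjective : Function.Surjective π.colN := by
  intro L
  choose t ht using fun i ↦ π.hcol_surj (L i)
  refine ⟨∑ i, (t i).comp (Pi.evalAddMonoidHom
    (fun _ : Fin n => ↥(Sprung2012.localTowerPointsOfEmb κ (closureEmb (K := ℚ) (π.v.adicCompletion ℚ)) W)) i), funext fun j ↦ ?_⟩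
  rw [colN_apply, ← ht j]
  refine congrArg π.col (AddMonoidHom.ext fun q ↦ ?_)
  rw [AddMonoidHom.comp_apply, AddMonoidHom.finsetSum_apply, Finset.sum_eq_single j]
  · rw [AddMonoidHom.comp_apply, Pi.evalAddMonoidHom_apply, AddMonoidHom.single_apply, Pi.single_eq_same]
  · intro i _ hij
    rw [AddMonoidHom.comp_apply, Pi.evalAddMonoidHom_apply, AddMonoidHom.single_apply, Pi.single_eq_of_ne hij, map_zero]
  · intro hj
    exact absurd (Finset.mem_univ j) hj

/-- **`𝒸 : 𝐇¹ →+ ℤ₂⟦X⟧ⁿ`** as an additive map (`colN ∘ locd₂`). [cite: Kobayashi2003, Thm. 6.2 (p. 18)] -/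
def cvecHom : I.H →+ (Fin n → PowerSeries ℤ_[2]) :=
  π.colN.toAddMonoidHom.comp π.locd₂

/-- `cvecHom x = 𝒸 x` (definitional). [cite: Kobayashi2003, Thm. 6.2 (p. 18)] -/
theorem cvecHom_apply (x : I.H) : π.cvecHom x = π.cvec x := rfl

/-- **Descent along `colN`**: an additive map on `P₀` that kills `ker colN` (S2's (KER) clause, read through `colN_apply`) factors UNIQUELY through
`colN`. [cite: Kobayashi2003, Thm. 6.2 (p. 18)] -/
theorem exists_descend_of_ker_colN {T : Type*} [AddCommGroup T]
    (f : ((Fin n → ↥(Sprung2012.localTowerPointsOfEmb κ (closureEmb (K := ℚ) (π.v.adicCompletion ℚ)) W)) →+ ℤ_[2]) →+ T)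
    (hf : ∀ t, π.colN t = 0 → f t = 0) :
    ∃! g : (Fin n → PowerSeries ℤ_[2]) →+ T, ∀ t, g (π.colN t) = f t := by
  have hker : π.colN.toAddMonoidHom.ker ≤ f.ker := fun t ht ↦ (AddMonoidHom.mem_ker).2 (hf t ((AddMonoidHom.mem_ker).1 ht))
  refine ⟨(π.colN.toAddMonoidHom.liftOfRightInverse (Function.surjInv π.colN_surjective)
      (Function.rightInverse_surjInv π.colN_surjective)) ⟨f, hker⟩, fun t ↦ ?_, fun g hg ↦ ?_⟩
  · exact π.colN.toAddMonoidHom.liftOfRightInverse_comp_apply (Function.surjInv π.colN_surjective)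
      (Function.rightInverse_surjInv π.colN_surjective) ⟨f, hker⟩ t
  · refine AddMonoidHom.ext fun F ↦ ?_
    obtain ⟨t, rfl⟩ := π.colN_surjective F
    rw [hg t]
    exact (π.colN.toAddMonoidHom.liftOfRightInverse_comp_apply (Function.surjInv π.colN_surjective)
      (Function.rightInverse_surjInv π.colN_surjective) ⟨f, hker⟩ t).symm

end OnePairPins

/-! ## §2 The S₀-side pairing, the supply localisation and the supply pairing -/

section Supply

variable (S : Set (PadicAlgCl 2)) (κ : ZpExtension ℚ 2) (ρ : FramedGaloisRep ℚ ↥(padicCoeffIntegers S) 2) (S₀ : Finset (HeightOneSpectrum (𝓞 ℚ)))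
  (Sg : AddSubgroup (subgroupH1 κ.kerSubgroup (Cofree ρ ↥(padicCoeffField S))))

/-- `locAway` is additive in the global class. [cite: GreenbergVatsal2000, §2] -/
theorem locAway_add (s s' : subgroupH1 κ.kerSubgroup (Cofree ρ ↥(padicCoeffField S))) (w : ↥S₀)
    (c : Cosets κ (w : HeightOneSpectrum (𝓞 ℚ))) :
    locAway S κ ρ S₀ (s + s') w c = locAway S κ ρ S₀ s w c + locAway S κ ρ S₀ s' w c := by
  unfold locAway
  rw [map_add, map_add]

/-- The cosets `Γ_ℚ ⧸ Γ_{n_w}` are finite (`[Γ_ℚ : Γ_m] = 2^m`). [cite: Washington1997, §13.1] -/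
theorem finite_cosets (w : HeightOneSpectrum (𝓞 ℚ)) : Finite (Cosets κ w) := by
  haveI : (κ.layerSubgroup (nfl w)).FiniteIndex :=
    ⟨by rw [κ.index_layerSubgroup (nfl w)]; exact pow_ne_zero _ two_ne_zero⟩
  exact Subgroup.finite_quotient_of_finiteIndex

/-- **The S₀-side pairing `P_{S₀} →+ Sg⋆`**: `χ ↦ (s ↦ ∑_{w ∈ S₀} ∑ᶠ_{c} χ w c (locAway s w c))` — the sum of the registered texts EH / S4₀ (`cS := id`).
[cite: GreenbergVatsal2000, §2 Prop. 2.4] [cite: MilneADT2006, Ch. I, Thm. 4.10] -/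
def pairAway : PAway S κ ρ S₀ →+ CharacterModule ↥Sg where
  toFun χ :=
    { toFun := fun s ↦ ∑ w : ↥S₀, ∑ᶠ c : Cosets κ (w : HeightOneSpectrum (𝓞 ℚ)),
        χ w c (locAway S κ ρ S₀ (s : subgroupH1 κ.kerSubgroup (Cofree ρ ↥(padicCoeffField S))) w c)
      map_zero' := by
        refine Finset.sum_eq_zero fun w _ ↦ finsum_eq_zero_of_forall_eq_zero fun c ↦ ?_
        rw [ZeroMemClass.coe_zero]
        unfold locAway
        rw [map_zero, map_zero, map_zero]
      map_add' := fun s s' ↦ by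
        rw [← Finset.sum_add_distrib]
        refine Finset.sum_congr rfl fun w _ ↦ ?_
        haveI : Finite (Cosets κ (w : HeightOneSpectrum (𝓞 ℚ))) := finite_cosets κ w
        rw [← finsum_add_distrib (Set.toFinite _) (Set.toFinite _)]
        exact finsum_congr fun c ↦ by rw [AddMemClass.coe_add, locAway_add, map_add] }
  map_zero' := by
    refine AddMonoidHom.ext fun s ↦ ?_
    exact Finset.sum_eq_zero fun w _ ↦ finsum_eq_zero_of_forall_eq_zero fun c ↦ rfl
  map_add' χ χ' := by
    refine AddMonoidHom.ext fun s ↦ ?_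
    change ∑ w : ↥S₀, ∑ᶠ c : Cosets κ (w : HeightOneSpectrum (𝓞 ℚ)), (χ + χ') w c (locAway S κ ρ S₀ s w c) =
      (∑ w : ↥S₀, ∑ᶠ c : Cosets κ (w : HeightOneSpectrum (𝓞 ℚ)), χ w c (locAway S κ ρ S₀ s w c)) +
        ∑ w : ↥S₀, ∑ᶠ c : Cosets κ (w : HeightOneSpectrum (𝓞 ℚ)), χ' w c (locAway S κ ρ S₀ s w c)
    rw [← Finset.sum_add_distrib]
    refine Finset.sum_congr rfl fun w _ ↦ ?_
    haveI : Finite (Cosets κ (w : HeightOneSpectrum (𝓞 ℚ))) := finite_cosets κ w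
    rw [← finsum_add_distrib (Set.toFinite _) (Set.toFinite _)]
    exact finsum_congr fun c ↦ rfl

/-- Unfolding `pairAway`. [cite: GreenbergVatsal2000, §2 Prop. 2.4] -/
theorem pairAway_apply (χ : PAway S κ ρ S₀) (s : ↥Sg) :
    pairAway S κ ρ S₀ Sg χ s = ∑ w : ↥S₀, ∑ᶠ c : Cosets κ (w : HeightOneSpectrum (𝓞 ℚ)),
      χ w c (locAway S κ ρ S₀ (s : subgroupH1 κ.kerSubgroup (Cofree ρ ↥(padicCoeffField S))) w c) :=
  rfl

/-- **The supply pairing `pair : ℤ₂⟦X⟧ⁿ × P_{S₀} →+ Sg⋆`**, `(F, χ) ↦ c̄₂ F + pairAway χ`, for a 2-side pairing `c̄₂` on `ℤ₂⟦X⟧ⁿ` (in the assembly: the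
descent of S2's `pair₂` along `colN`, `OnePairPins.exists_descend_of_ker_colN`). [cite: Kobayashi2003, Thm. 7.3] [cite: MilneADT2006, Ch. I, Thm. 4.10] -/
def supplyPair {n : ℕ} (c₂bar : (Fin n → PowerSeries ℤ_[2]) →+ CharacterModule ↥Sg) :
    ((Fin n → PowerSeries ℤ_[2]) × PAway S κ ρ S₀) →+ CharacterModule ↥Sg :=
  c₂bar.coprod (pairAway S κ ρ S₀ Sg)

/-- Unfolding `supplyPair`: `pair (F, χ) s = c̄₂ F s + ∑_w ∑ᶠ_c χ w c (locAway s w c)`. [cite: Kobayashi2003, Thm. 7.3] -/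
theorem supplyPair_apply {n : ℕ} (c₂bar : (Fin n → PowerSeries ℤ_[2]) →+ CharacterModule ↥Sg)
    (t : (Fin n → PowerSeries ℤ_[2]) × PAway S κ ρ S₀) (s : ↥Sg) :
    supplyPair S κ ρ S₀ Sg c₂bar t s =
      c₂bar t.1 s + ∑ w : ↥S₀, ∑ᶠ c : Cosets κ (w : HeightOneSpectrum (𝓞 ℚ)),
        t.2 w c (locAway S κ ρ S₀ (s : subgroupH1 κ.kerSubgroup (Cofree ρ ↥(padicCoeffField S))) w c) := by
  rw [supplyPair, AddMonoidHom.coprod_apply]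
  rfl


variable {S κ ρ S₀ Sg} {W : WeierstrassCurve ℚ} [W.IsElliptic] {γ : absoluteGaloisGroup ℚ} {n : ℕ}
  {Θ : ∀ v : HeightOneSpectrum (𝓞 ℚ), ((2 : ℕ) : 𝓞 ℚ) ∈ v.asIdeal → (Cofree ρ ↥(padicCoeffField S) ≃+ (Fin n → ↥(W.geomPrimaryTorsion 2)))}
  {hΘ : ∀ v hv (δ : absoluteGaloisGroup (v.adicCompletion ℚ)) m i,
    Θ v hv (resGalOfEmb (closureEmb (K := ℚ) (v.adicCompletion ℚ)) δ • m) i = resGalOfEmb (closureEmb (K := ℚ) (v.adicCompletion ℚ)) δ • Θ v hv m i}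
  {I : Kato2004.IwasawaH1DataCoeff (FramedGaloisRep.toGaloisRep ρ) 2 κ γ} [Module ↥(padicCoeffIntegers S) ↥Sg]
  (π : OnePairPins S W κ γ S₀ n ρ Θ hΘ I Sg) [∀ w : ↥S₀, Module ℤ_[2] (Dloc S κ ρ (w : HeightOneSpectrum (𝓞 ℚ)))]
  (πₐ : AwayPins S κ ρ S₀ W γ n Θ hΘ I Sg π)

/-- **The supply localisation `locd : 𝐇¹ →+ ℤ₂⟦X⟧ⁿ × P_{S₀}`**, `x ↦ (𝒸 x, locd_S x)` (GLUE-SPEC-g18 §0 / ASSEMBLY-SPEC-g19 §0).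
[cite: Kobayashi2003, Thm. 7.3] [cite: Kato2004Asterisque, §13.8 (p. 228)] -/
def supplyLocd : I.H →+ (Fin n → PowerSeries ℤ_[2]) × PAway S κ ρ S₀ :=
  π.cvecHom.prod πₐ.locdS

/-- Unfolding `supplyLocd` (definitional). [cite: Kobayashi2003, Thm. 7.3] -/
theorem supplyLocd_apply (x : I.H) : supplyLocd π πₐ x = (π.cvec x, πₐ.locdS x) := rfl

end Supply

end Summit.BirchSwinnertonDyer.BirchSwinnertonDyer.Theorems.OnePair

end
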